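import Mathlib
import HarnessLib

/-!
# Smoothing coboundary II — orbit re-indexing (CS3/CS5 core), the Frobenius bit (CS4 core) and the `𝔽₄`-Vandermonde of the
# level-`0` rung R0 (seed crux `SignedMuSeedAtTwoPlus` stmt-BirchSwinnertonDyer-21438; parent Kμ⁺ `SignedMuVanishingAtTwoPlus`
# stmt-BirchSwinnertonDyer-20689, route ResidualThetaTransportAtTwo; line card `Cruxes/SignedMuSeedAtTwoPlus/Lines/smoothing-coboundary.md`)

Cell `bsd-wall`, width seat `bsd-wall-rtt-p4-w2` g15 (`--supports`, closes nothing).  THEOREMS ONLY; BSD is not proved by this.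

Pure commutative algebra behind three steps of the card `Ideas/smoothing-coboundary.md` (k1 g25):

* ORBIT RE-INDEXING (why the orbit functionals inherit the cocycle; CS3 at level `0`, CS5 at all orders).  A family of
  functions `L a : G → R` (resp. `G → V`) on a finite commutative "orbit group" `G` (geometrically `(𝒪_K/𝔣₀)ˣ` acting on the
  `𝔣₀`-torsion orbit) with the twisted cocycle law `L (a*b) c = L b c + τ b * L a (φ b * c)` (resp. `… + τ b • ρ b (L a (φ b * c))`)
  gives, for every character `χ : G →* R`, an orbit functional `Σ_c χ c * L a c` (resp. `Σ_c χ c • L a c`) satisfying the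
  SCALAR (resp. OPERATOR) twisted cocycle law of `…SmoothingCoboundary` with multiplier `η b = τ b * χ (φ b)⁻¹`
  (card: `η = ω̃·χ₀^e`): **`orbitSum_cocycle`**, **`orbitSum_opCocycle`**.  The re-indexing is `c ↦ φ b * c` (`Fintype.sum_equiv`).
* FROBENIUS BIT (CS4 core).  In characteristic `2`, if the multiplier is cube-root-of-unity valued (`η a ^ 3 = 1`), `σ` inverts it
  (`η (σ a) * η a = 1`) and the coboundary `f a = κ * (η a - 1)` satisfies a Frobenius law `f a ^ 2 = ε * f (σ a)`, then ONE `a` with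
  `η a ≠ 1` forces `κ ∈ {0, ε}` — one bit per (class, twist): **`frobeniusBit`** (from `eq_zero_or_eq_of_sq_mul_eq`).
* `𝔽₄`-VANDERMONDE (rung R0, character-free form).  With `ω² + ω + 1 = 0` in characteristic `2`, the two twisted sums
  `S₀ + ω S₁ + ω² S₂`, `S₀ + ω² S₁ + ω S₂` both vanish iff `S₀ = S₁ = S₂` (**`twistedSums_eq_zero_iff`**), and together with the
  trivial-twist vanishing `S₀ + S₁ + S₂ = 0` iff all three coset sums vanish (**`allSums_eq_zero_iff`**): «both twists silent at
  level 0 ⟺ the three cubic-coset sums of `D log ψ_α` over `Ẽ[q] ∖ O` are equal».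

[folklore]
-/

set_option autoImplicit false
-- the Theorems namespace of this sub repeats the summit name by design (D-0017 nested layout)
set_option linter.dupNamespace false

open Finset

namespace Summit.BirchSwinnertonDyer.BirchSwinnertonDyer.Theorems.SignedMuAtTwo.SmoothingCoboundary

/-! ## Orbit re-indexing -/

section Orbit

variable {M R G : Type*} [CommMonoid M] [CommRing R] [CommGroup G]
  (φ : M →* G) (τ : M →* R) (χ : G →* R)

/-- A character of a group into a commutative ring inverts along group inversion: `χ c⁻¹ * χ c = 1`. [folklore] -/
theorem char_inv_mul_self (c : G) : χ c⁻¹ * χ c = 1 := by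
  rw [← map_mul, inv_mul_cancel, map_one]

/-- **Orbit re-indexing, scalar form** (CS3 core): if `L (a * b) c = L b c + τ b * L a (φ b * c)` on a finite commutative
orbit group, then for every character `χ` the orbit functional `f a := Σ_c χ c * L a c` is a twisted cocycle
`f (a * b) = f b + (τ b * χ (φ b)⁻¹) * f a`. [folklore] -/
theorem orbitSum_cocycle [Fintype G] (L : M → G → R) (hL : ∀ a b c, L (a * b) c = L b c + τ b * L a (φ b * c)) (a b : M) :
    (∑ c, χ c * L (a * b) c) = (∑ c, χ c * L b c) + (τ b * χ (φ b)⁻¹) * ∑ c, χ c * L a c := by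
  simp_rw [hL, mul_add, sum_add_distrib]
  congr 1
  rw [mul_sum]
  refine Fintype.sum_equiv (Equiv.mulLeft (φ b)) _ _ fun c => ?_
  simp only [Equiv.coe_mulLeft, map_mul]
  linear_combination (-(τ b * χ c * L a (φ b * c))) * char_inv_mul_self χ (φ b)

/-- The multiplier of the orbit functional, `b ↦ τ b * χ (φ b)⁻¹`, is itself a monoid hom (so `…SmoothingCoboundary.coboundaryLaw`
applies to `orbitSum_cocycle` verbatim). [folklore] -/
theorem orbitMultiplier_map_mul (a b : M) :
    τ (a * b) * χ (φ (a * b))⁻¹ = (τ a * χ (φ a)⁻¹) * (τ b * χ (φ b)⁻¹) := by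
  rw [map_mul, map_mul, mul_inv, map_mul]; ring

/-- The multiplier at `1` is `1`. [folklore] -/
theorem orbitMultiplier_map_one : τ 1 * χ (φ 1)⁻¹ = 1 := by
  rw [map_one, map_one, inv_one, map_one, one_mul]

variable {V : Type*} [AddCommGroup V] [Module R V] (ρ : M →* Module.End R V)

/-- **Orbit re-indexing, operator form** (CS5 core): if `L (a * b) c = L b c + τ b • ρ b (L a (φ b * c))` with a commuting
family of linear operators `ρ`, then `F a := Σ_c χ c • L a c` satisfies `F (a * b) = F b + (τ b * χ (φ b)⁻¹) • ρ b (F a)`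
(the FULL-orbit law of the card; the half orbit is not `[β]`-equivariant away from `O`). [folklore] -/
theorem orbitSum_opCocycle [Fintype G] (L : M → G → V) (hL : ∀ a b c, L (a * b) c = L b c + τ b • ρ b (L a (φ b * c))) (a b : M) :
    (∑ c, χ c • L (a * b) c) = (∑ c, χ c • L b c) + (τ b * χ (φ b)⁻¹) • ρ b (∑ c, χ c • L a c) := by
  simp_rw [hL, smul_add, sum_add_distrib]
  congr 1
  rw [map_sum, smul_sum]
  refine Fintype.sum_equiv (Equiv.mulLeft (φ b)) _ _ fun c => ?_
  simp only [Equiv.coe_mulLeft, map_mul, map_smul, smul_smul]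
  congr 1
  linear_combination (-(τ b * χ c)) * char_inv_mul_self χ (φ b)

end Orbit

/-! ## The Frobenius bit -/

section Frobenius

variable {R : Type*} [CommRing R]

/-- `κ² c = ε κ c` with `c ≠ 0` in a domain forces `κ = 0 ∨ κ = ε`. [folklore] -/
theorem eq_zero_or_eq_of_sq_mul_eq [IsDomain R] {κ ε c : R} (hc : c ≠ 0) (h : κ ^ 2 * c = ε * κ * c) :
    κ = 0 ∨ κ = ε := by
  have h' : κ * (κ - ε) = 0 := by
    have h2 := mul_right_cancel₀ hc h
    linear_combination h2
  rcases mul_eq_zero.mp h' with h0 | h0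
  · exact Or.inl h0
  · exact Or.inr (sub_eq_zero.mp h0)

/-- In characteristic `2`, `(x - 1)² = x² - 1`. [folklore] -/
theorem sub_one_sq_charTwo [CharP R 2] (x : R) : (x - 1) ^ 2 = x ^ 2 - 1 := by
  have h2 : (2 : R) = 0 := CharTwo.two_eq_zero
  linear_combination (1 - x) * h2

variable {M : Type*} [CommMonoid M]

/-- A cube-root-of-unity valued multiplier: `σ` with `η (σ a) * η a = 1` satisfies `η (σ a) = η a ^ 2`. [folklore] -/
theorem multiplier_conj_eq_sq [IsDomain R] (η : M →* R) (σ : M → M) (hcube : ∀ a, η a ^ 3 = 1)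
    (hσ : ∀ a, η (σ a) * η a = 1) (a : M) : η (σ a) = η a ^ 2 := by
  have hne : η a ≠ 0 := by
    intro h0
    have := hcube a
    rw [h0] at this
    norm_num at this
  apply mul_right_cancel₀ hne
  rw [hσ a, ← pow_succ, hcube a]

/-- **Frobenius bit** (CS4 core): in a domain of characteristic `2`, a coboundary `f a = κ * (η a - 1)` with cube-root-of-unity
multiplier (`η a ^ 3 = 1`), an involution-like `σ` inverting the multiplier (`η (σ a) * η a = 1`) and the Frobenius law
`f a ^ 2 = ε * f (σ a)` has `κ ∈ {0, ε}` as soon as ONE `η a ≠ 1` (card (C): `κ_χ ∈ {0, ε_χ}`, one bit per (class, twist)).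
[folklore] -/
theorem frobeniusBit [IsDomain R] [CharP R 2] (η : M →* R) (f : M → R) (σ : M → M) {κ ε : R}
    (hκ : ∀ a, f a = κ * (η a - 1)) (hcube : ∀ a, η a ^ 3 = 1) (hσ : ∀ a, η (σ a) * η a = 1)
    (hfrob : ∀ a, f a ^ 2 = ε * f (σ a)) {a : M} (ha : η a ≠ 1) : κ = 0 ∨ κ = ε := by
  have hsq : η (σ a) = η a ^ 2 := multiplier_conj_eq_sq η σ hcube hσ a
  have hc : η (σ a) - 1 ≠ 0 := by
    intro h0
    apply ha
    have h1 : η (σ a) = 1 := sub_eq_zero.mp h0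
    have := hσ a
    rwa [h1, one_mul] at this
  refine eq_zero_or_eq_of_sq_mul_eq hc ?_
  have h := hfrob a
  rw [hκ a, hκ (σ a), mul_pow, sub_one_sq_charTwo, ← hsq] at h
  linear_combination h

end Frobenius

/-! ## The `𝔽₄`-Vandermonde of rung R0 -/

section Vandermonde

variable {R : Type*} [CommRing R] [CharP R 2] {ω : R} (hω : ω ^ 2 + ω + 1 = 0)
include hω

/-- **Both twisted sums vanish iff the three coset sums are equal** (char `2`, `ω² + ω + 1 = 0`):
`S₀ + ω S₁ + ω² S₂ = 0 ∧ S₀ + ω² S₁ + ω S₂ = 0 ⟺ S₀ = S₁ ∧ S₁ = S₂` — the character-free form of «both twists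
`χ₀^{±1}` silent at level 0» in rung R0 of the card. [folklore] -/
theorem twistedSums_eq_zero_iff (S₀ S₁ S₂ : R) :
    (S₀ + ω * S₁ + ω ^ 2 * S₂ = 0 ∧ S₀ + ω ^ 2 * S₁ + ω * S₂ = 0) ↔ (S₀ = S₁ ∧ S₁ = S₂) := by
  have h2 : (2 : R) = 0 := CharTwo.two_eq_zero
  constructor
  · rintro ⟨e1, e2⟩
    have h12 : S₁ = S₂ := by
      linear_combination -e1 - e2 + (S₀ - S₂) * h2 + (S₁ + S₂) * hω
    refine ⟨?_, h12⟩
    linear_combination e1 - S₁ * hω + ω ^ 2 * h12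
  · rintro ⟨h01, h12⟩
    constructor
    · linear_combination h01 + S₁ * hω - ω ^ 2 * h12
    · linear_combination h01 + S₁ * hω - ω * h12

/-- With the trivial-twist vanishing `S₀ + S₁ + S₂ = 0` (card: `Σ_{P ∈ Ẽ[q]∖O} L(α)(P) = ([q]_* L(α))(O) = 0` at inert `q`),
all three twisted sums vanish iff every coset sum vanishes. [folklore] -/
theorem allSums_eq_zero_iff (S₀ S₁ S₂ : R) :
    (S₀ + S₁ + S₂ = 0 ∧ S₀ + ω * S₁ + ω ^ 2 * S₂ = 0 ∧ S₀ + ω ^ 2 * S₁ + ω * S₂ = 0) ↔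
      (S₀ = 0 ∧ S₁ = 0 ∧ S₂ = 0) := by
  have h2 : (2 : R) = 0 := CharTwo.two_eq_zero
  constructor
  · rintro ⟨e0, e12⟩
    obtain ⟨h01, h12⟩ := (twistedSums_eq_zero_iff hω S₀ S₁ S₂).mp e12
    have h0 : S₀ = 0 := by
      linear_combination e0 + 2 * h01 + h12 - S₀ * h2
    refine ⟨h0, ?_, ?_⟩
    · linear_combination h0 - h01
    · linear_combination h0 - h01 - h12
  · rintro ⟨h0, h1, h2'⟩
    refine ⟨?_, ?_, ?_⟩
    · rw [h0, h1, h2']; ring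
    · rw [h0, h1, h2']; ring
    · rw [h0, h1, h2']; ring

/-- Under the trivial-twist vanishing, «both twists silent» ⟺ «all three coset sums vanish». [folklore] -/
theorem twistedSums_eq_zero_iff_of_sum_eq_zero (S₀ S₁ S₂ : R) (h0 : S₀ + S₁ + S₂ = 0) :
    (S₀ + ω * S₁ + ω ^ 2 * S₂ = 0 ∧ S₀ + ω ^ 2 * S₁ + ω * S₂ = 0) ↔ (S₀ = 0 ∧ S₁ = 0 ∧ S₂ = 0) := by
  rw [← allSums_eq_zero_iff hω S₀ S₁ S₂]
  exact ⟨fun h => ⟨h0, h⟩, fun h => h.2⟩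

end Vandermonde

end Summit.BirchSwinnertonDyer.BirchSwinnertonDyer.Theorems.SignedMuAtTwo.SmoothingCoboundary
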